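import Literature.NumberTheory.EllipticCurves.OrdinaryReductionTorsionLineProofs
import Literature.NumberTheory.EllipticCurves.SupersingularTorsionValuationProofs
import Literature.NumberTheory.EllipticCurves.FormalGroupChart
import Literature.NumberTheory.GaloisRepresentations.FundamentalCharacterCyclotomicProofs
import Literature.NumberTheory.GaloisRepresentations.SerreWeightEqTwoShapesProofs
import HarnessLib

/-!
# The inertia shape `diag(ψ₂^p, ψ₂)` of `ρ̄_{E,p}|I_p` at a good supersingular prime
# (Serre 1972, §1.11, Prop. 12; Serre 1987, §2.2, (2.8.3) and Prop. 4)

`Proofs` file (theorems only: no definition, no named fact), topic `NumberTheory/EllipticCurves`;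
sequel of `OrdinaryReductionTorsionLineProofs` (the local good-reduction setup),
`SupersingularTorsionValuationProofs` (`|x(P)|^{(p²-1)/2} = |p|⁻¹` on `E[p] ∖ 0`),
`FormalGroupChart` (the parameter `z = -x/y` and its first-order additivity on `E₁`) and
`GaloisRepresentations/FundamentalCharacterCyclotomicProofs` (the Kummer character through any
element of the right absolute value).

J.-P. Serre, Invent. Math. 15 (1972), §1.11 ("bonne réduction de hauteur 2"), Prop. 10 and
Prop. 12 for `e = 1`: at a place of good SUPERSINGULAR reduction with `e = f = 1`, the tame
inertia group acts on `E_p` through the fundamental character `ψ₂` of level `2`: `E_p` is an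
`𝔽_{p²}`-line.  Serre, Duke Math. J. 54 (1987), §2.8, Prop. 4 / (2.8.3): `ρ̄_p|I ≅ (ψ' 0; 0 ψ)`,
so `k(ρ̄) = 2`.

* `WeierstrassCurve.exists_additive_equivariant_of_dvd_frobeniusTraceAt` — Serre's additive,
  injective, `ψ₂`-equivariant map `θ : E[p] → k` (the construction below);
* `WeierstrassCurve.IsTorsionGaloisRep.hasLevelTwoInertiaShape_of_additive_equivariant` — the
  semilinear algebra turning such a `θ` into the inertia shape `diag(ψ₂^q, ψ₂)`;
* `WeierstrassCurve.hasLevelTwoInertiaShape_restrictField_of_dvd_frobeniusTraceAt` — for an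
  elliptic curve `E` over a number field `K`, an odd prime `p`, a place `v ∣ p` of good
  supersingular reduction (`p ∣ a_v`) with `e(v ∣ p) = f(v ∣ p) = 1` (`𝔪_v = p𝓞_v`,
  `#k_v = p`, `p` a uniformiser of `K_v`; e.g. `K = ℚ`), a framing `ρ̄` of `E[p]`, any
  `j : 𝔽_p → k` and residue embedding `ι`: the local representation `(ρ̄ ⊗_j k)|Γ_{K_v}` has the
  level-two inertia shape `HasLevelTwoInertiaShape ι p _ 0 1`, i.e. `diag(ψ₂^p, ψ₂)` in a
  suitable basis.

Proof (Serre's, on the local model `MO/𝒪_w` of `exists_goodReduction_localModel`): every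
`P ∈ E[p] ∖ 0` has local avatar `A_P` in the kernel of reduction with `|z(A_P)|^{p²-1} = |p|`
(`one_lt_valuation_X_of_prime_zsmul_eq_zero_of_hasseCoeff_mem`, `val_X_mul_val_zCoord_sq`), the
absolute value of the Kummer root `π`, `π^{p²-1} = p`, defining `ψ₂`; the map
`θ : E[p] → k`, `P ↦ ι(z(A_P)/π mod 𝔓)` is additive (`val_zCoord_add_sub_le`: the error has
absolute value `≤ |π|²`), injective, and `θ(σP) = ψ₂(σ) θ(P)` for `σ ∈ I_{K_v}`
(`coe_kummerCharacter_eq_residue_smul_div` with `z = z(A_P)`, Serre's Lemma, §1.7 Prop. 3).  With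
`u = θ(e⁻¹ e₀)`, `u' = θ(e⁻¹ e₁)` this reads `(u u') M = ψ₂(σ) (u u')` for the matrix `M` of
`σ`, and, applying Frobenius, `(u^p u'^p) M = ψ₂(σ)^p (u^p u'^p)`; the matrix
`P = (u^p u'^p; u u')` is invertible because `u, u'` are `𝔽_p`-independent
(`pow_mul_sub_ne_zero_of_forall_eq_zero`, a Moore determinant), and `P M P⁻¹ = diag(ψ₂^p, ψ₂)`.

## References

* [SerreInventiones1972] J.-P. Serre, Invent. Math. 15 (1972) 259–331, §1.7 Prop. 3, §1.10
  Prop. 10, §1.11 Prop. 12.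
* [Serre1987] J.-P. Serre, Duke Math. J. 54 (1987), §2.2, §2.8 Prop. 4, (2.8.3).
* [SilvermanAEC2009] J. H. Silverman, *The Arithmetic of Elliptic Curves*, 2nd ed. (2009),
  IV.1, VII.2.2.
-/

noncomputable section

open scoped Classical NNReal NumberField AddSubgroup
open NumberField IsDedekindDomain Polynomial

universe u

namespace Literature.NumberTheory.EllipticCurves

/-! ## §1 A Moore determinant: `u^p u' ≠ u'^p u` for `𝔽_p`-independent `u, u'` -/

/-- In a field `k` of characteristic `p`, the solutions of `c ^ p = c` are the images of `𝔽_p`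
(the `p` roots of `X^p - X`). [folklore] -/
theorem exists_eq_cast_of_pow_char_eq {k : Type*} [Field k] (p : ℕ) [hp : Fact p.Prime]
    [CharP k p] (j : ZMod p →+* k) {c : k} (hc : c ^ p = c) : ∃ m : ZMod p, j m = c := by
  set f : k[X] := X ^ p - X with hf
  have hp1 : 1 < p := hp.out.one_lt
  have hf0 : f ≠ 0 := FiniteField.X_pow_card_sub_X_ne_zero k hp1
  have hdeg : f.natDegree = p := FiniteField.X_pow_card_sub_X_natDegree_eq k hp1
  -- the `p` distinct images of `𝔽_p` are roots
  have hroots : ∀ m : ZMod p, j m ∈ f.roots := by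
    intro m
    rw [Polynomial.mem_roots hf0, IsRoot, hf, eval_sub, eval_pow, eval_X, ← map_pow, ZMod.pow_card,
      sub_self]
  have hsub : (Finset.univ.image j) ⊆ f.roots.toFinset := by
    intro x hx
    obtain ⟨m, -, rfl⟩ := Finset.mem_image.mp hx
    exact Multiset.mem_toFinset.mpr (hroots m)
  have hcard : (Finset.univ.image j : Finset k).card = p := by
    rw [Finset.card_image_of_injective _ j.injective, Finset.card_univ, ZMod.card]
  have hle : f.roots.toFinset.card ≤ p := by
    calc f.roots.toFinset.card ≤ Multiset.card f.roots := Multiset.toFinset_card_le _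
      _ ≤ f.natDegree := Polynomial.card_roots' f
      _ = p := hdeg
  have heq : Finset.univ.image j = f.roots.toFinset :=
    Finset.eq_of_subset_of_card_le hsub (by rw [hcard]; exact hle)
  have hcmem : c ∈ f.roots.toFinset := by
    rw [Multiset.mem_toFinset, Polynomial.mem_roots hf0, IsRoot, hf, eval_sub, eval_pow, eval_X, hc,
      sub_self]
  rw [← heq] at hcmem
  obtain ⟨m, -, hm⟩ := Finset.mem_image.mp hcmem
  exact ⟨m, hm⟩

/-- **A Moore determinant.**  If `u, u' ∈ k` (`char k = p`) are `𝔽_p`-linearly independent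
(`a u + b u' = 0 ⇒ a = b = 0` for `a, b ∈ 𝔽_p`), then `u^p u' - u'^p u ≠ 0`: otherwise
`c = u/u'` satisfies `c^p = c`, so `c ∈ 𝔽_p` and `u = c u'`. [folklore] -/
theorem pow_mul_sub_ne_zero_of_forall_eq_zero {k : Type*} [Field k] (p : ℕ) [hp : Fact p.Prime]
    [CharP k p] (j : ZMod p →+* k) {u u' : k}
    (hind : ∀ a b : ZMod p, j a * u + j b * u' = 0 → a = 0 ∧ b = 0) :
    u ^ p * u' - u' ^ p * u ≠ 0 := by
  have hu' : u' ≠ 0 := by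
    intro h0
    have := (hind 0 1 (by rw [h0, map_zero, map_one, zero_mul, mul_zero, add_zero])).2
    exact one_ne_zero this
  intro hdet
  set c := u / u' with hc
  have hcu : u = c * u' := by rw [hc, div_mul_cancel₀ u hu']
  have hcp : c ^ p = c := by
    have hp1 : p = (p - 1) + 1 := (Nat.sub_add_cancel hp.out.one_le).symm
    have h1 : u ^ p * u' = u' ^ p * u := sub_eq_zero.mp hdet
    rw [hcu, mul_pow] at h1
    -- `c^p u'^p u' = u'^p c u'`
    have h2 : (c ^ p - c) * (u' ^ p * u') = 0 := by linear_combination h1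
    rcases mul_eq_zero.mp h2 with h3 | h3
    · exact sub_eq_zero.mp h3
    · exact absurd h3 (mul_ne_zero (pow_ne_zero _ hu') hu')
  obtain ⟨m, hm⟩ := exists_eq_cast_of_pow_char_eq p j hcp
  have := (hind 1 (-m) (by rw [map_one, one_mul, map_neg, hm, hcu]; ring)).1
  exact one_ne_zero this

/-! ## §1b `w ≤` versus `algNorm ≤` for the spectral valuation -/

section Spectral

open Literature.NumberTheory.GaloisRepresentations IsDedekindDomain.HeightOneSpectrum
  Literature.NumberTheory.GaloisRepresentations.IsNonarchimedeanLocalField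

/-- **The two absolute values of `K̄_v` define the same order**: for the spectral valuation `w`
(`(w x : ℝ) = spectralNorm K_v K̄_v x`, Mathlib's norm on `K_v`) and the tree's `algNorm K_v`
(the spectral norm for the valuation norm of the GalRep files), `w a ≤ w b ↔ ‖a‖ ≤ ‖b‖` — both
are absolute values with the same closed unit ball (`spectralValuation_le_one_iff_algNorm_le_one`).
[folklore] -/
theorem spectralValuation_le_iff_algNorm_le {K : Type} [Field K] [NumberField K]
    {v : HeightOneSpectrum (𝓞 K)} {w : Valuation (AlgebraicClosure (v.adicCompletion K)) ℝ≥0}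
    (hw : ∀ x, (w x : ℝ) =
      spectralNorm (v.adicCompletion K) (AlgebraicClosure (v.adicCompletion K)) x)
    (a b : AlgebraicClosure (v.adicCompletion K)) :
    w a ≤ w b ↔ algNorm (v.adicCompletion K) a ≤ algNorm (v.adicCompletion K) b := by
  by_cases hb : b = 0
  · subst hb
    rw [map_zero, algNorm_zero, nonpos_iff_eq_zero, map_eq_zero,
      ← algNorm_eq_zero_iff (F := v.adicCompletion K)]
    exact ⟨fun h ↦ le_of_eq h, fun h ↦ le_antisymm h (algNorm_nonneg _)⟩
  · have hb' : 0 < algNorm (v.adicCompletion K) b := algNorm_pos_iff.mpr hb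
    have hwb : 0 < w b := (Valuation.pos_iff _).mpr hb
    rw [← div_le_one₀ hwb, ← map_div₀, spectralValuation_le_one_iff_algNorm_le_one hw, algNorm_div,
      div_le_one hb']

end Spectral

/-! ## §2 The level-two shape at a good supersingular prime -/

section NumberField

open _root_.WeierstrassCurve Literature.NumberTheory.GaloisRepresentations Field
  IsDedekindDomain.HeightOneSpectrum
  Literature.NumberTheory.GaloisRepresentations.IsNonarchimedeanLocalField
  Literature.NumberTheory.GaloisRepresentations.ModPGaloisRep ValuativeRel

set_option maxHeartbeats 400000 in
/-- **Serre's additive embedding `θ : E[p] ↪ k` at a good supersingular prime** (Serre 1972,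
§1.10 Prop. 10, §1.11 Prop. 12, `e = 1`).  In the situation of
`hasLevelTwoInertiaShape_restrictField_of_dvd_frobeniusTraceAt` there is a map `θ : E(K̄) → k`
which on `E[p]` is additive and injective and satisfies `θ(σ X) = ψ₂(σ) θ(X)` for `σ` in the
inertia group of `K_v` (acting through `res : Γ_{K_v} → Γ_K`), `ψ₂` the level-two fundamental
character w.r.t. the uniformiser `p`: namely `θ(X) = ι(z(A X)/π mod 𝔓)` for the local avatar
`A X ∈ E₁(K̄_v)` of `X`, `z = -x/y`, `π^{p²-1} = p` (module docstring).
[cite: SerreInventiones1972, §1.10 Prop. 10, §1.11 Prop. 12, §1.7 Prop. 3] -/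
theorem _root_.WeierstrassCurve.exists_additive_equivariant_of_dvd_frobeniusTraceAt
    {K : Type} [Field K] [NumberField K]
    (W : WeierstrassCurve K) [W.IsElliptic] (p : ℕ) [hp : Fact p.Prime] (hp2 : p ≠ 2)
    (v : HeightOneSpectrum (𝓞 K)) (hpv : (p : 𝓞 K) ∈ v.asIdeal) (hgood : W.HasGoodReductionAt v)
    (hss : (p : ℤ) ∣ W.frobeniusTraceAt v)
    (hgen : ∀ c ∈ IsLocalRing.maximalIdeal (v.adicCompletionIntegers K),
      ((p : ℕ) : v.adicCompletionIntegers K) ∣ c)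
    {k : Type} [Field k]
    (hirr : Irreducible ((p : ℕ) : 𝒪[v.adicCompletion K]))
    (hq : residueFieldCard (v.adicCompletion K) = p)
    (ι : absIntegers 𝒪[v.adicCompletion K] (v.adicCompletion K) ⧸
      absMaximalIdeal (v.adicCompletion K) →+* k) :
    ∃ θ : geomPoints W → k,
      (∀ X ∈ geomTorsion W p, ∀ Y ∈ geomTorsion W p, θ (X + Y) = θ X + θ Y) ∧
      (∀ X ∈ geomTorsion W p, θ X = 0 → X = 0) ∧
      (∀ (σ : absInertia (v.adicCompletion K)), ∀ X ∈ geomTorsion W p,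
        θ (absGaloisRestrict K (v.adicCompletion K)
            (σ : absoluteGaloisGroup (v.adicCompletion K)) • X) =
          (fundamentalCharacter (v.adicCompletion K) 2 ι ((p : ℕ) : 𝒪[v.adicCompletion K])
            hirr σ : k) * θ X) := by
  classical
  haveI : CharZero (v.adicCompletion K) :=
    charZero_of_injective_algebraMap (algebraMap K (v.adicCompletion K)).injective
  haveI : CharZero (AlgebraicClosure (v.adicCompletion K)) :=
    charZero_of_injective_algebraMap
      (algebraMap (v.adicCompletion K) (AlgebraicClosure (v.adicCompletion K))).injective
  have hp0 : p ≠ 0 := hp.out.ne_zero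
  /- Step 0: the local setup `w`, `MO = M.map φ`, `Φ = congrEquiv hX ∘ Φ₀`, `A = Φ ∘ pointsMap`. -/
  obtain ⟨w, hw, φ, Φ₀, hX, hφ, hΔO, hΦ₀⟩ := exists_goodReduction_localModel W v hgood
  have hvO : w.Integers w.valuationSubring := Valuation.valuationSubring.integers w
  let A : geomPoints W →+ (((W.localMinimalIntegralModel v).map φ).baseChange
      (AlgebraicClosure (v.adicCompletion K))).toAffine.Point :=
    ((Φ₀.trans (Affine.Point.congrEquiv hX)).toAddMonoidHom).comp
      (pointsMap W (v.adicCompletion K))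
  have hAdef : ∀ X, A X = Affine.Point.congrEquiv hX (Φ₀ (pointsMap W (v.adicCompletion K) X)) :=
    fun X ↦ rfl
  have hAinj : Function.Injective A := fun X Y hXY ↦
    pointsMapOfEmb_injective W (closureEmb (K := K) (v.adicCompletion K))
      (Φ₀.injective ((Affine.Point.congrEquiv hX).injective hXY))
  let σE : absoluteGaloisGroup (v.adicCompletion K) →
      (AlgebraicClosure (v.adicCompletion K) →ₐ[v.adicCompletion K]
        AlgebraicClosure (v.adicCompletion K)) := fun σ ↦
    ((absoluteGaloisGroup.toAlgEquiv (v.adicCompletion K) σ :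
        AlgebraicClosure (v.adicCompletion K) ≃ₐ[v.adicCompletion K]
          AlgebraicClosure (v.adicCompletion K)) :
      AlgebraicClosure (v.adicCompletion K) →ₐ[v.adicCompletion K]
        AlgebraicClosure (v.adicCompletion K))
  have hσE : ∀ σ z, σE σ z = σ • z := fun σ z ↦ rfl
  have hAσ : ∀ (σ : absoluteGaloisGroup (v.adicCompletion K)) (X : geomPoints W),
      A (absGaloisRestrict K (v.adicCompletion K) σ • X) =
        Affine.Point.congrEquiv hX (Affine.Point.map (σE σ)
          (Φ₀ (pointsMap W (v.adicCompletion K) X))) := by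
    intro σ X
    rw [hAdef, ← resGal_eq_absGaloisRestrict, pointsMap_smul, hΦ₀]
  -- `z(A(σ X)) = σ z(A X)`
  have hzσ : ∀ (σ : absoluteGaloisGroup (v.adicCompletion K)) (X : geomPoints W),
      (A (absGaloisRestrict K (v.adicCompletion K) σ • X)).zCoord = σ • (A X).zCoord := by
    intro σ X
    rw [hAσ, hAdef]
    rcases Φ₀ (pointsMap W (v.adicCompletion K) X) with _ | ⟨x, y, hxy⟩
    · rw [← Affine.Point.zero_def, Affine.Point.map_zero, _root_.map_zero, Affine.Point.zCoord_zero,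
        smul_zero]
    · rw [Affine.Point.map_some, Affine.Point.congrEquiv_some, Affine.Point.congrEquiv_some,
        Affine.Point.zCoord_some, Affine.Point.zCoord_some, hσE, hσE, absoluteGaloisGroup.smul_def,
        absoluteGaloisGroup.smul_def, absoluteGaloisGroup.smul_def, map_div₀, map_neg]
  /- Step 1: `MO_{K̄_v}` is `w`-integral; residue characteristic `p`. -/
  haveI hint : (((W.localMinimalIntegralModel v).map φ).baseChange
      (AlgebraicClosure (v.adicCompletion K))).IsIntegral w.integer := by
    refine isIntegral_of_exists_lift _ ⟨⟨_, ?_⟩, rfl⟩ ⟨⟨_, ?_⟩, rfl⟩ ⟨⟨_, ?_⟩, rfl⟩ ⟨⟨_, ?_⟩, rfl⟩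
      ⟨⟨_, ?_⟩, rfl⟩
    all_goals exact (Valuation.mem_integer_iff _ _).mpr (hvO.map_le_one _)
  have hpw : w ((p : ℕ) : AlgebraicClosure (v.adicCompletion K)) < 1 := by
    have h := spectralValuation_algebraMap_ringOfIntegers_lt_one (v := v) hw hpv
    rwa [map_natCast] at h
  have hpL : ((p : ℕ) : AlgebraicClosure (v.adicCompletion K)) ≠ 0 := Nat.cast_ne_zero.mpr hp0
  have hpw0 : 0 < w ((p : ℕ) : AlgebraicClosure (v.adicCompletion K)) :=
    (Valuation.pos_iff _).mpr hpL
  /- Step 2: every `P ∈ MO(K̄_v)[p]` affine has `|x| > 1` and `|p| |x|^{(p²-1)/2} = 1`. -/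
  have htors : ∀ {x y : AlgebraicClosure (v.adicCompletion K)}
      {h : (((W.localMinimalIntegralModel v).map φ).baseChange
        (AlgebraicClosure (v.adicCompletion K))).toAffine.Nonsingular x y},
      (p : ℤ) • (Affine.Point.some x y h : (((W.localMinimalIntegralModel v).map φ).baseChange
        (AlgebraicClosure (v.adicCompletion K))).toAffine.Point) = 0 →
      1 < w x ∧ w ((p : ℕ) : AlgebraicClosure (v.adicCompletion K)) * w x ^ ((p ^ 2 - 1) / 2) = 1 := by
    intro x y h hpP
    letI : Algebra (v.adicCompletionIntegers K) (AlgebraicClosure (v.adicCompletion K)) :=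
      ((algebraMap w.valuationSubring (AlgebraicClosure (v.adicCompletion K))).comp φ).toAlgebra
    have hcurve : (W.localMinimalIntegralModel v).map
        (algebraMap (v.adicCompletionIntegers K) (AlgebraicClosure (v.adicCompletion K))) =
        ((W.localMinimalIntegralModel v).map φ).baseChange (AlgebraicClosure (v.adicCompletion K)) := by
      rw [WeierstrassCurve.baseChange, WeierstrassCurve.map_map]
      rfl
    haveI : CharP (IsLocalRing.ResidueField (v.adicCompletionIntegers K)) p :=
      charP_residueField_adicCompletionIntegers hpv
    have hR : ∀ c : v.adicCompletionIntegers K,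
        w (algebraMap (v.adicCompletionIntegers K) (AlgebraicClosure (v.adicCompletion K)) c) ≤ 1 :=
      fun c ↦ hvO.map_le_one (φ c)
    have hΔ := isUnit_Δ_localMinimalIntegralModel hgood
    have hHasse := W.hasseCoeff_localMinimalIntegralModel_mem_maximalIdeal hp2 hpv hgood hss
    have hpP' : (p : ℤ) • (Affine.Point.some x y (hcurve ▸ h) :
        ((W.localMinimalIntegralModel v).map (algebraMap (v.adicCompletionIntegers K)
          (AlgebraicClosure (v.adicCompletion K)))).toAffine.Point) = 0 := by
      have := congrArg (Affine.Point.congrEquiv hcurve.symm) hpP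
      rwa [map_zsmul, Affine.Point.congrEquiv_some, _root_.map_zero] at this
    exact one_lt_valuation_X_of_prime_zsmul_eq_zero_of_hasseCoeff_mem hp2 hR hgen hpw hpL _ hΔ
      hHasse hpP'
  /- Step 3: `A(E[p]) ⊆ E₁`, and `|z(A X)|^{p²-1} = |p|` for `X ∈ E[p] ∖ 0`. -/
  have hker : ∀ X ∈ geomTorsion W p,
      A X ∈ FormalGroupChart.kernel w (((W.localMinimalIntegralModel v).map φ).baseChange
        (AlgebraicClosure (v.adicCompletion K))) := by
    intro X hXt
    have hpX : (p : ℤ) • A X = 0 := by rw [← map_zsmul, mem_torsionBy_iff.mp hXt, A.map_zero]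
    revert hpX
    rcases A X with _ | ⟨x, y, h⟩
    · intro; rw [← Affine.Point.zero_def]; exact zero_mem _
    · intro hpX; rw [FormalGroupChart.some_mem_kernel_iff h]; exact (htors hpX).1
  have hzval : ∀ X ∈ geomTorsion W p, X ≠ 0 →
      w (A X).zCoord ^ (p ^ 2 - 1) = w ((p : ℕ) : AlgebraicClosure (v.adicCompletion K)) := by
    intro X hXt hX0
    have hpX : (p : ℤ) • A X = 0 := by rw [← map_zsmul, mem_torsionBy_iff.mp hXt, A.map_zero]
    have hkX : A X ∈ FormalGroupChart.kernel w (((W.localMinimalIntegralModel v).map φ).baseChange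
        (AlgebraicClosure (v.adicCompletion K))) := hker X hXt
    have hA0 : A X ≠ 0 := fun h0 ↦ hX0 (hAinj (by rw [h0, A.map_zero]))
    revert hpX hkX hA0
    rcases A X with _ | ⟨x, y, h⟩
    · intro _ _ hA0; exact (hA0 (Affine.Point.zero_def).symm).elim
    · intro hpX hkX _
      obtain ⟨hx1, hxp⟩ := htors hpX
      obtain ⟨h1, -, -⟩ := FormalGroupChart.val_X_mul_val_zCoord_sq hkX
      rw [Affine.Point.zCoord_some]
      have heven : 2 * ((p ^ 2 - 1) / 2) = p ^ 2 - 1 := by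
        obtain ⟨m, hm⟩ := hp.out.odd_of_ne_two hp2
        subst hm
        have : (2 * m + 1) ^ 2 - 1 = 2 * (2 * m * m + 2 * m) := by
          rw [show (2 * m + 1) ^ 2 = 2 * (2 * m * m + 2 * m) + 1 by ring, Nat.add_sub_cancel]
        rw [this, Nat.mul_div_cancel_left _ two_pos]
      have h3 : w x ^ ((p ^ 2 - 1) / 2) * (w (-x / y) ^ 2) ^ ((p ^ 2 - 1) / 2) = 1 := by
        rw [← mul_pow, h1, one_pow]
      calc w (-x / y) ^ (p ^ 2 - 1) = (w (-x / y) ^ 2) ^ ((p ^ 2 - 1) / 2) := by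
            rw [← pow_mul, heven]
        _ = w ((p : ℕ) : AlgebraicClosure (v.adicCompletion K)) *
              (w x ^ ((p ^ 2 - 1) / 2) * (w (-x / y) ^ 2) ^ ((p ^ 2 - 1) / 2)) := by
            rw [← mul_assoc, hxp, one_mul]
        _ = w ((p : ℕ) : AlgebraicClosure (v.adicCompletion K)) := by rw [h3, mul_one]
  /- Step 4: the Kummer root `π`, `π^{q²-1} = p`, `|z(A X)| = |π|`. -/
  have hn : 0 < residueFieldCard (v.adicCompletion K) ^ 2 - 1 :=
    residueFieldCard_pow_sub_one_pos (v.adicCompletion K) two_ne_zero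
  have hnp : residueFieldCard (v.adicCompletion K) ^ 2 - 1 = p ^ 2 - 1 := by rw [hq]
  set π : AlgebraicClosure (v.adicCompletion K) :=
    (kummerRoot (v.adicCompletion K) hn ((p : ℕ) : 𝒪[v.adicCompletion K]) :
      AlgebraicClosure (v.adicCompletion K)) with hπdef
  have hπ0 : π ≠ 0 := coe_kummerRoot_ne_zero hn hirr.ne_zero
  have hπnorm : algNorm (v.adicCompletion K) π ^ (p ^ 2 - 1) =
      algNorm (v.adicCompletion K) ((p : ℕ) : AlgebraicClosure (v.adicCompletion K)) := by
    rw [← hnp, hπdef, algNorm_kummerRoot_pow, map_natCast]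
  have hwπ : w π ^ (p ^ 2 - 1) = w ((p : ℕ) : AlgebraicClosure (v.adicCompletion K)) := by
    have h1 := hπnorm
    rw [← algNorm_pow] at h1
    have hle := (spectralValuation_le_iff_algNorm_le hw _ _).mpr h1.le
    have hge := (spectralValuation_le_iff_algNorm_le hw _ _).mpr h1.ge
    rw [Valuation.map_pow] at hle hge
    exact le_antisymm hle hge
  have hwπ1 : w π < 1 := by
    by_contra hle
    rw [not_lt] at hle
    have : 1 ≤ w π ^ (p ^ 2 - 1) := one_le_pow₀ hle
    rw [hwπ] at this
    exact absurd hpw (not_lt.mpr this)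
  have hwπ0 : 0 < w π := (Valuation.pos_iff _).mpr hπ0
  -- `|z(A X)| = |π|` on `E[p] ∖ 0`, `≤ |π|` on `E[p]`; the same for `algNorm`
  have hne : p ^ 2 - 1 ≠ 0 := by
    have h3 : 3 ≤ p := by have := hp.out.two_le; omega
    have : 9 ≤ p ^ 2 := by nlinarith
    omega
  have hwz : ∀ X ∈ geomTorsion W p, X ≠ 0 → w (A X).zCoord = w π := by
    intro X hXt hX0
    have h1 : w (A X).zCoord ^ (p ^ 2 - 1) = w π ^ (p ^ 2 - 1) := by rw [hzval X hXt hX0, hwπ]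
    exact (pow_left_inj₀ zero_le zero_le hne).mp h1
  have hwz_le : ∀ X ∈ geomTorsion W p, w (A X).zCoord ≤ w π := by
    intro X hXt
    by_cases hX0 : X = 0
    · subst hX0; rw [A.map_zero, Affine.Point.zCoord_zero, _root_.map_zero]; exact zero_le
    · exact (hwz X hXt hX0).le
  have hnz : ∀ X ∈ geomTorsion W p, X ≠ 0 →
      algNorm (v.adicCompletion K) (A X).zCoord = algNorm (v.adicCompletion K) π := by
    intro X hXt hX0
    exact le_antisymm ((spectralValuation_le_iff_algNorm_le hw _ _).mp (hwz X hXt hX0).le)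
      ((spectralValuation_le_iff_algNorm_le hw _ _).mp (hwz X hXt hX0).ge)
  have hπn0 : algNorm (v.adicCompletion K) π ≠ 0 := (algNorm_pos_iff.mpr hπ0).ne'
  have hnorm_div : ∀ X ∈ geomTorsion W p, algNorm (v.adicCompletion K) ((A X).zCoord / π) ≤ 1 := by
    intro X hXt
    by_cases hX0 : X = 0
    · subst hX0; rw [A.map_zero, Affine.Point.zCoord_zero, zero_div, algNorm_zero]; exact zero_le_one
    · rw [algNorm_div, hnz X hXt hX0, div_self hπn0]
  /- Step 5: the map `θ : E[p] → k`, `X ↦ ι(z(A X)/π mod 𝔓)`. -/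
  let θ : geomPoints W → k := fun X ↦
    ι (IsNonarchimedeanLocalField.residue (v.adicCompletion K) ((A X).zCoord / π))
  have hθdef : ∀ X, θ X =
      ι (IsNonarchimedeanLocalField.residue (v.adicCompletion K) ((A X).zCoord / π)) :=
    fun X ↦ rfl
  have hθ0 : θ 0 = 0 := by
    rw [hθdef, A.map_zero, Affine.Point.zCoord_zero, zero_div, residue_zero, ι.map_zero]
  -- additivity (`z` is additive to first order on `E₁`, the error being `≤ |π|² < |π|`)
  have hθadd : ∀ X ∈ geomTorsion W p, ∀ Y ∈ geomTorsion W p, θ (X + Y) = θ X + θ Y := by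
    intro X hXt Y hYt
    rw [hθdef, hθdef, hθdef, ← ι.map_add, A.map_add]
    congr 1
    set err := (A X + A Y).zCoord - (A X).zCoord - (A Y).zCoord with herr
    have herr_le : w err ≤ w π ^ 2 :=
      (FormalGroupChart.val_zCoord_add_sub_le (hker X hXt) (hker Y hYt)).trans
        (pow_le_pow_left' (max_le (hwz_le X hXt) (hwz_le Y hYt)) 2)
    have herr_div_w : w (err / π) < 1 := by
      rw [map_div₀]
      calc w err / w π ≤ w π ^ 2 / w π := by gcongr
        _ = w π := by rw [sq, mul_div_cancel_right₀ _ hwπ0.ne']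
        _ < 1 := hwπ1
    have herr_div : algNorm (v.adicCompletion K) (err / π) < 1 :=
      (spectralValuation_lt_one_iff_algNorm_lt_one hw _).mp herr_div_w
    have hsplit : (A X + A Y).zCoord / π = ((A X).zCoord / π + (A Y).zCoord / π) + err / π := by
      rw [herr]; ring
    have hsum_le : algNorm (v.adicCompletion K) ((A X).zCoord / π + (A Y).zCoord / π) ≤ 1 :=
      (algNorm_add_le _ _).trans (max_le (hnorm_div X hXt) (hnorm_div Y hYt))
    rw [hsplit, residue_add hsum_le herr_div.le, residue_add (hnorm_div X hXt) (hnorm_div Y hYt),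
      (residue_eq_zero_iff herr_div.le).mpr herr_div, add_zero]
  -- equivariance under inertia: `θ(σ X) = ψ₂(σ) θ(X)`
  have hθsmul : ∀ (σ : absInertia (v.adicCompletion K)), ∀ X ∈ geomTorsion W p,
      θ (absGaloisRestrict K (v.adicCompletion K) (σ : absoluteGaloisGroup (v.adicCompletion K)) • X) =
        (fundamentalCharacter (v.adicCompletion K) 2 ι ((p : ℕ) : 𝒪[v.adicCompletion K]) hirr σ : k) *
          θ X := by
    intro σ X hXt
    by_cases hX0 : X = 0
    · subst hX0; rw [smul_zero, hθ0, mul_zero]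
    rw [hθdef, hθdef, hzσ]
    have hz0 : (A X).zCoord ≠ 0 := by
      intro h0
      exact hX0 (hAinj (((FormalGroupChart.zCoord_eq_zero_iff (hker X hXt)).mp h0).trans
        A.map_zero.symm))
    have hsplit : (σ : absoluteGaloisGroup (v.adicCompletion K)) • (A X).zCoord / π =
        ((σ : absoluteGaloisGroup (v.adicCompletion K)) • (A X).zCoord / (A X).zCoord) *
          ((A X).zCoord / π) := by
      field_simp
    have hn1 : algNorm (v.adicCompletion K)
        ((σ : absoluteGaloisGroup (v.adicCompletion K)) • (A X).zCoord / (A X).zCoord) ≤ 1 :=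
      (algNorm_smul_div_self _ hz0).le
    rw [hsplit, residue_mul hn1 (hnorm_div X hXt), ι.map_mul]
    congr 1
    rw [fundamentalCharacter_of_ne_zero (v.adicCompletion K) two_ne_zero,
      coe_kummerCharacter_eq_residue_smul_div hn hirr.ne_zero ι σ]
    rw [hnp, hnz X hXt hX0, hπnorm, map_natCast]
  -- injectivity
  have hθinj : ∀ X ∈ geomTorsion W p, θ X = 0 → X = 0 := by
    intro X hXt hθX
    by_contra hX0
    have h1 : algNorm (v.adicCompletion K) ((A X).zCoord / π) = 1 := by
      rw [algNorm_div, hnz X hXt hX0, div_self hπn0]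
    have h2 : IsNonarchimedeanLocalField.residue (v.adicCompletion K) ((A X).zCoord / π) ≠ 0 := by
      intro h0
      rw [residue_eq_zero_iff h1.le, h1] at h0
      exact lt_irrefl _ h0
    rw [hθdef] at hθX
    exact h2 (residueEmbedding_injective ι (by rw [ι.map_zero]; exact hθX))
  exact ⟨θ, hθadd, hθinj, hθsmul⟩

/-- **From Serre's embedding to the inertia shape `diag(ψ₂^q, ψ₂)`** (the semilinear algebra of
Serre 1972, §1.10–1.11, "`E_p` is an `𝔽_{p²}`-line").  Let `ρ̄` frame `E[p]` and let
`θ : E[p] → k` be additive, injective and `ψ`-equivariant for the inertia group of `K_v`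
(`θ(σ X) = ψ(σ) θ(X)`, `ψ = ψ₂` the level-two fundamental character), as produced by
`exists_additive_equivariant_of_dvd_frobeniusTraceAt`.  With `r_c = θ(e⁻¹ e_c)` the matrix `M`
of `σ` satisfies `(r₀ r₁) M = ψ(σ) (r₀ r₁)` and, by Frobenius, `(r₀^p r₁^p) M = ψ(σ)^p (r₀^p r₁^p)`;
`P = (r₀^p r₁^p; r₀ r₁)` is invertible (Moore determinant, `pow_mul_sub_ne_zero_of_forall_eq_zero`)
and `P M P⁻¹ = diag(ψ^p, ψ) = diag(ψ^{#k_v}, ψ)`: the local representation `(ρ̄ ⊗_j k)|Γ_{K_v}`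
has `HasLevelTwoInertiaShape ι ϖ hϖ 0 1`. [cite: SerreInventiones1972, §1.10 Prop. 10, §1.11 Prop. 12] -/
theorem _root_.WeierstrassCurve.IsTorsionGaloisRep.hasLevelTwoInertiaShape_of_additive_equivariant
    {K : Type} [Field K] [NumberField K]
    {W : WeierstrassCurve K} [W.IsElliptic] {p : ℕ} [hp : Fact p.Prime]
    (v : HeightOneSpectrum (𝓞 K)) {ρ : ModPGaloisRep K (ZMod p) 2} (hρ : W.IsTorsionGaloisRep p ρ)
    {k : Type} [Field k] [TopologicalSpace k] (j : ZMod p →+* k) (hj : Continuous j)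
    {ϖ : 𝒪[v.adicCompletion K]} (hϖ : Irreducible ϖ)
    (ι : absIntegers 𝒪[v.adicCompletion K] (v.adicCompletion K) ⧸
      absMaximalIdeal (v.adicCompletion K) →+* k)
    (hq : residueFieldCard (v.adicCompletion K) = p)
    (θ : geomPoints W → k)
    (hθadd : ∀ X ∈ geomTorsion W p, ∀ Y ∈ geomTorsion W p, θ (X + Y) = θ X + θ Y)
    (hθinj : ∀ X ∈ geomTorsion W p, θ X = 0 → X = 0)
    (hθsmul : ∀ (σ : absInertia (v.adicCompletion K)), ∀ X ∈ geomTorsion W p,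
      θ (absGaloisRestrict K (v.adicCompletion K)
          (σ : absoluteGaloisGroup (v.adicCompletion K)) • X) =
        (fundamentalCharacter (v.adicCompletion K) 2 ι ϖ hϖ σ : k) * θ X) :
    ModPGaloisRep.HasLevelTwoInertiaShape
      (FramedGaloisRep.restrictField (v.adicCompletion K) (FramedRep.baseChange j hj ρ) :
        ModPGaloisRep (v.adicCompletion K) k 2) ι ϖ hϖ 0 1 := by
  classical
  haveI hchark : CharP k p := charP_of_injective_ringHom j.injective p
  haveI : ExpChar k p := ExpChar.prime hp.out
  have hθ0 : θ 0 = 0 := by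
    have h := hθadd 0 (zero_mem _) 0 (zero_mem _)
    rw [add_zero] at h
    linear_combination -h
  -- `ℕ`-linearity
  have hθnsmul : ∀ (n : ℕ), ∀ X ∈ geomTorsion W p, θ (n • X) = (n : k) * θ X := by
    intro n X hXt
    induction n with
    | zero => rw [zero_nsmul, hθ0, Nat.cast_zero, zero_mul]
    | succ n ih =>
      rw [succ_nsmul, hθadd _ (AddSubgroup.nsmul_mem _ hXt n) _ hXt, ih, Nat.cast_succ]
      ring
  /- Step 6: the frame `X_c = e⁻¹(e_c)`, `r c = θ(X_c)`, and the row identities. -/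
  obtain ⟨e, he⟩ := id hρ
  let r : Fin 2 → k := fun c ↦ θ ((e.symm (Pi.single c 1) : geomTorsion W p) : geomPoints W)
  have hrdef : ∀ c, r c = θ ((e.symm (Pi.single c 1) : geomTorsion W p) : geomPoints W) :=
    fun c ↦ rfl
  have hcast : ∀ a : ZMod p, (((a.val : ℕ) : k)) = j a := fun a ↦ by
    rw [← map_natCast j, ZMod.natCast_zmod_val]
  -- `θ(e⁻¹ vv) = j(vv 0) r 0 + j(vv 1) r 1`
  have hlin : ∀ vv : Fin 2 → ZMod p,
      θ ((e.symm vv : geomTorsion W p) : geomPoints W) = j (vv 0) * r 0 + j (vv 1) * r 1 := by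
    intro vv
    have hvv : vv = (vv 0).val • Pi.single (0 : Fin 2) (1 : ZMod p) +
        (vv 1).val • Pi.single (1 : Fin 2) (1 : ZMod p) := by
      ext i
      fin_cases i
      · show vv 0 = (vv 0).val • (Pi.single (0 : Fin 2) (1 : ZMod p) : Fin 2 → ZMod p) 0 +
          (vv 1).val • (Pi.single (1 : Fin 2) (1 : ZMod p) : Fin 2 → ZMod p) 0
        rw [Pi.single_eq_same, Pi.single_eq_of_ne (by decide), smul_zero, add_zero, nsmul_eq_mul,
          mul_one, ZMod.natCast_zmod_val]
      · show vv 1 = (vv 0).val • (Pi.single (0 : Fin 2) (1 : ZMod p) : Fin 2 → ZMod p) 1 +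
          (vv 1).val • (Pi.single (1 : Fin 2) (1 : ZMod p) : Fin 2 → ZMod p) 1
        rw [Pi.single_eq_same, Pi.single_eq_of_ne (by decide), smul_zero, zero_add, nsmul_eq_mul,
          mul_one, ZMod.natCast_zmod_val]
    have h1 : ((e.symm vv : geomTorsion W p) : geomPoints W) =
        (vv 0).val • ((e.symm (Pi.single 0 1) : geomTorsion W p) : geomPoints W) +
          (vv 1).val • ((e.symm (Pi.single 1 1) : geomTorsion W p) : geomPoints W) := by
      conv_lhs => rw [hvv]
      rw [e.symm.map_add, map_nsmul e.symm, map_nsmul e.symm, AddSubgroup.coe_add,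
        AddSubgroup.coe_nsmul, AddSubgroup.coe_nsmul]
    rw [h1, hθadd _ (AddSubgroup.nsmul_mem _ (e.symm (Pi.single 0 1)).2 _) _
      (AddSubgroup.nsmul_mem _ (e.symm (Pi.single 1 1)).2 _),
      hθnsmul _ _ (e.symm (Pi.single 0 1)).2, hθnsmul _ _ (e.symm (Pi.single 1 1)).2, hcast, hcast]
  -- `𝔽_p`-independence of `r 0, r 1`
  have hind : ∀ a b : ZMod p, j a * r 0 + j b * r 1 = 0 → a = 0 ∧ b = 0 := by
    intro a b hab
    have h1 : θ ((e.symm ![a, b] : geomTorsion W p) : geomPoints W) = 0 := by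
      rw [hlin]; exact hab
    have h2 : ((e.symm ![a, b] : geomTorsion W p) : geomPoints W) = 0 :=
      hθinj _ (e.symm ![a, b]).2 h1
    have h3 : (e.symm ![a, b] : geomTorsion W p) = 0 := Subtype.ext h2
    have h4 : (![a, b] : Fin 2 → ZMod p) = 0 := by
      have := congrArg e h3
      rwa [AddEquiv.apply_symm_apply, e.map_zero] at this
    exact ⟨by simpa using congrFun h4 0, by simpa using congrFun h4 1⟩
  -- row identity (A): `Σ_i j(M i c) r i = ψ(σ) r c`
  have hrowA : ∀ (σ : absInertia (v.adicCompletion K)) (c : Fin 2),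
      j (((ρ (absGaloisRestrict K (v.adicCompletion K) σ) : GL (Fin 2) (ZMod p)) :
          Matrix (Fin 2) (Fin 2) (ZMod p)) 0 c) * r 0 +
        j (((ρ (absGaloisRestrict K (v.adicCompletion K) σ) : GL (Fin 2) (ZMod p)) :
          Matrix (Fin 2) (Fin 2) (ZMod p)) 1 c) * r 1 =
        (fundamentalCharacter (v.adicCompletion K) 2 ι ϖ hϖ σ : k) *
          r c := by
    intro σ c
    set g := absGaloisRestrict K (v.adicCompletion K) σ with hg
    set M : Matrix (Fin 2) (Fin 2) (ZMod p) :=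
      ((ρ g : GL (Fin 2) (ZMod p)) : Matrix (Fin 2) (Fin 2) (ZMod p)) with hM
    -- `e⁻¹ (M e_c) = g • e⁻¹ e_c`
    have hcol : M.mulVec (Pi.single c 1) = fun i ↦ M i c := by
      ext i; rw [Matrix.mulVec_single_one]; rfl
    have hsymm : (e.symm (fun i ↦ M i c) : geomTorsion W p) = g • e.symm (Pi.single c 1) := by
      rw [AddEquiv.symm_apply_eq, he g, AddEquiv.apply_symm_apply, ← hM, hcol]
    have h1 := hlin (fun i ↦ M i c)
    rw [hsymm, AddSubgroup.torsionBy.coe_smul, hθsmul σ _ (e.symm (Pi.single c 1)).2] at h1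
    rw [← hrdef] at h1
    exact h1.symm
  -- row identity (B): Frobenius of (A)
  have hfrobj : ∀ m : ZMod p, j m ^ p = j m := fun m ↦ by rw [← map_pow, ZMod.pow_card]
  have hrowB : ∀ (σ : absInertia (v.adicCompletion K)) (c : Fin 2),
      j (((ρ (absGaloisRestrict K (v.adicCompletion K) σ) : GL (Fin 2) (ZMod p)) :
          Matrix (Fin 2) (Fin 2) (ZMod p)) 0 c) * r 0 ^ p +
        j (((ρ (absGaloisRestrict K (v.adicCompletion K) σ) : GL (Fin 2) (ZMod p)) :
          Matrix (Fin 2) (Fin 2) (ZMod p)) 1 c) * r 1 ^ p =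
        (fundamentalCharacter (v.adicCompletion K) 2 ι ϖ hϖ σ : k) ^ p *
          r c ^ p := by
    intro σ c
    rw [← mul_pow, ← hrowA σ c, add_pow_char, mul_pow, mul_pow, hfrobj, hfrobj]
  /- Step 7: the change of basis `P = (r₀^p r₁^p; r₀ r₁)`. -/
  set Pm : Matrix (Fin 2) (Fin 2) k := !![r 0 ^ p, r 1 ^ p; r 0, r 1] with hPm
  have hdet : Pm.det ≠ 0 := by
    rw [hPm, Matrix.det_fin_two_of]
    exact pow_mul_sub_ne_zero_of_forall_eq_zero p j hind
  refine ⟨Matrix.GeneralLinearGroup.mkOfDetNeZero Pm hdet, fun σ ↦ ?_⟩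
  set ψ : k := (fundamentalCharacter (v.adicCompletion K) 2 ι ϖ hϖ σ : k) with hψ
  set M : Matrix (Fin 2) (Fin 2) (ZMod p) :=
    ((ρ (absGaloisRestrict K (v.adicCompletion K) σ) : GL (Fin 2) (ZMod p)) :
      Matrix (Fin 2) (Fin 2) (ZMod p)) with hM
  -- the local representation at `σ` is `M.map j`
  have hloc : ((FramedGaloisRep.restrictField (v.adicCompletion K) (FramedRep.baseChange j hj ρ) :
      ModPGaloisRep (v.adicCompletion K) k 2) (σ : absoluteGaloisGroup (v.adicCompletion K)) :
        Matrix (Fin 2) (Fin 2) k) = M.map j := by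
    rw [FramedGaloisRep.restrictField_apply, FramedRep.coe_baseChange_apply]
  -- `Pm (M.map j) = diag(ψ^p, ψ) Pm`
  have hkey : Pm * M.map j = !![ψ ^ p, 0; 0, ψ] * Pm := by
    ext i c
    rw [Matrix.mul_apply, Matrix.mul_apply, Fin.sum_univ_two, Fin.sum_univ_two, Matrix.map_apply,
      Matrix.map_apply]
    have hA' := hrowA σ c
    have hB' := hrowB σ c
    rw [← hM, ← hψ] at hA' hB'
    fin_cases i <;> fin_cases c <;>
      simp only [hPm, Matrix.of_apply, Matrix.cons_val', Matrix.cons_val_zero, Matrix.cons_val_one,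
        Matrix.cons_val_fin_one, Matrix.empty_val', Fin.isValue, Fin.zero_eta, Fin.mk_one] at hA' hB' ⊢ <;>
      first | linear_combination hB' | linear_combination hA'
  -- conclusion: `P ρ(σ) P⁻¹ = diag(ψ^p, ψ) P P⁻¹ = diag(ψ^q, ψ)`
  have hPP : Pm * ((((Matrix.GeneralLinearGroup.mkOfDetNeZero Pm hdet)⁻¹ : GL (Fin 2) k)) :
      Matrix (Fin 2) (Fin 2) k) = 1 :=
    Units.mul_inv (Matrix.GeneralLinearGroup.mkOfDetNeZero Pm hdet)
  rw [Matrix.GeneralLinearGroup.coe_mul, Matrix.GeneralLinearGroup.coe_mul, hloc]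
  change Pm * M.map j * _ = _
  rw [hkey, mul_assoc, hPP, mul_one, hψ]
  simp only [zero_add, mul_one, mul_zero, pow_one, Units.val_pow_eq_pow_val, hq]

/-- **Serre 1972, §1.11 Prop. 12 (`e = 1`) / Serre 1987, (2.8.3): at a good supersingular prime,
`ρ̄_{E,p}|I_p ≅ diag(ψ₂^p, ψ₂)`.**  Let `E` be an elliptic curve over a number field `K`, `p` an
odd prime, `v ∣ p` a finite place of good SUPERSINGULAR reduction (`p ∣ a_v`) which is absolutely
unramified with residue field `𝔽_p` (`𝔪_v ⊆ p 𝓞_v`, `#k_v = p`, `p` a uniformiser of `K_v` — all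
automatic for `K = ℚ`), `ρ̄ : Γ_K → GL₂(𝔽_p)` a framing of `E[p]`, `j : 𝔽_p → k` a continuous
ring homomorphism into a topological field and `ι` a residue embedding for `K_v`.  Then the local
representation `(ρ̄ ⊗_j k)|Γ_{K_v}` has the level-two inertia shape `(0, 1)` of Serre's recipe:
in a suitable basis every `σ ∈ I_{K_v}` acts by `diag(ψ₂(σ)^{#k_v}, ψ₂(σ))`, `ψ₂` the
fundamental character of level two (with respect to the uniformiser `p`).  See the module
docstring for the proof.
[cite: SerreInventiones1972, §1.11 Prop. 12, §1.10 Prop. 10, §1.7 Prop. 3]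
[cite: Serre1987, §2.8 Prop. 4 and (2.8.3)] -/
theorem _root_.WeierstrassCurve.hasLevelTwoInertiaShape_restrictField_of_dvd_frobeniusTraceAt
    {K : Type} [Field K] [NumberField K]
    (W : WeierstrassCurve K) [W.IsElliptic] (p : ℕ) [hp : Fact p.Prime] (hp2 : p ≠ 2)
    (v : HeightOneSpectrum (𝓞 K)) (hpv : (p : 𝓞 K) ∈ v.asIdeal) (hgood : W.HasGoodReductionAt v)
    (hss : (p : ℤ) ∣ W.frobeniusTraceAt v)
    (hgen : ∀ c ∈ IsLocalRing.maximalIdeal (v.adicCompletionIntegers K),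
      ((p : ℕ) : v.adicCompletionIntegers K) ∣ c)
    {ρ : ModPGaloisRep K (ZMod p) 2} (hρ : W.IsTorsionGaloisRep p ρ)
    {k : Type} [Field k] [TopologicalSpace k] (j : ZMod p →+* k) (hj : Continuous j)
    (hirr : Irreducible ((p : ℕ) : 𝒪[v.adicCompletion K]))
    (hq : residueFieldCard (v.adicCompletion K) = p)
    (ι : absIntegers 𝒪[v.adicCompletion K] (v.adicCompletion K) ⧸
      absMaximalIdeal (v.adicCompletion K) →+* k) :
    ModPGaloisRep.HasLevelTwoInertiaShape
      (FramedGaloisRep.restrictField (v.adicCompletion K) (FramedRep.baseChange j hj ρ) :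
        ModPGaloisRep (v.adicCompletion K) k 2) ι ((p : ℕ) : 𝒪[v.adicCompletion K]) hirr 0 1 := by
  obtain ⟨θ, hθadd, hθinj, hθsmul⟩ :=
    W.exists_additive_equivariant_of_dvd_frobeniusTraceAt p hp2 v hpv hgood hss hgen hirr hq ι
  exact hρ.hasLevelTwoInertiaShape_of_additive_equivariant v j hj hirr ι hq θ hθadd hθinj hθsmul

end NumberField

end Literature.NumberTheory.EllipticCurves
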